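/-
Copyright (c) 2026 the pub-hodgecm-mathlib formalisation cell (harness21).  Prover seat hodgecm-mathlib-K2Liu-p13 (g4), Track B «K2-LIT»,
#184♮ = hLiu418 = `stmt-HodgeConjecture-24832`; ROAD Φ (RULING «M-156n»), #41 TOP — brick (E7″) of the (β) census `CENSUS-Beta-EulerFace.K2Liu-p13-g4.md`: at EVERY place `v`
where `χ_{F,v}` is UNRAMIFIED (good or bad, the `χ_w` above `v` ramified or not) the product `c_v(s)⁻¹ · aNorm 2 χ_v vol s` of the inverse local Gindikin–Karpelevich scalar of
★ p861784 `invScalar_eq_finsetProd_mul` and the normaliser of ★ A7-AllS0 is, on `re s > ½`, the explicit MODIFIED NORMALISER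
`m_v(s) = vol·(1−q^{−2s})(1−e q^{−2s})·L_{E∕F}(2s,χ_F∘N) ∕ [(1−q^{−(2s+1)})(1−e q^{−(2s+1)})·L_{E∕F}(2s+1,χ_F∘N)]` (`e` = Satake value of `χ_{F,v}`), and `m_v` is HOLOMORPHIC on
`{0 < re s}` — the pole of `L_F(2s−1,χ_F)` on `re s = ½` is cancelled by `c_v⁻¹` EXACTLY (both depend on `χ_F` only), the value of `L_{E∕F}` is never needed.
So the letters `(c κ v, hc)` of ★ `K2LiuBigCellContinuationOfFaces.exists_bigCell_continuation_cm_of_faces` at the `ε`-UNRAMIFIED bad places are `c κ v := m_v`.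
THEOREMS ONLY (no `def`, no `instance`, no named-fact hypothesis, no `sorry`).
-/
import Summits.HodgeConjecture.HodgeConjecture.Theorems.K2LiuA7NormaliserAlgebra                  -- ★ `aNum_two`, `bDen_two`, `lEN_ne_zero` (+ ★ `K2LiuQRationalLFactor`)
import Summits.HodgeConjecture.HodgeConjecture.Theorems.K2LiuBigCellContinuationPointLetters       -- ★ p861729 `differentiableOn_re_pos_of_forall_isQRationalRegularAt`
import Summits.HodgeConjecture.HodgeConjecture.Theorems.K2LiuA7ValueSocketHu                       -- ★ σ-9 `isUnramifiedChar_localComponent_iff`, `unramValue_localComponent_eq_valueAtUniformizer`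
import Summits.HodgeConjecture.HodgeConjecture.Theorems.K2E1HeckeCharBaseChangeLocalComponentsU    -- ★ J1a-dict `localComponent_eq_prod_of_comp_ideleBaseChange`
import Literature.NumberTheory.GaloisRepresentations.HeckeCharacterProofs                          -- ★ `norm_valueAtUniformizer_of_isUnitary`
import HarnessLib

/-!
# Crux `HLiu418`, ROAD Φ, organ Φ8 (row G6), brick (E7″): THE MODIFIED NORMALISER `c_v⁻¹ · aNorm 2` IS HOLOMORPHIC ON `{0 < re}` AT EVERY `χ_F`-UNRAMIFIED PLACE

Cell `hodgecm-mathlib`, crux item hLiu418 = `stmt-HodgeConjecture-24832` (helper lane, count-neutral).  Quadratic `E∕F`, involution `c`, finite place `v` of `F`, unitary local characters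
`χ_w` (`w ∣ v`) whose restriction `χ_{F,v}` (★ `chiF`) is UNRAMIFIED with Satake value `e` (`‖e‖ ≤ 1`), `q = q_v` (★ `residueFieldCard_adicCompletion_eq`).
* §1 **`invLocalScalar_mul_aNorm_two_eq`** — `[(1−q^{−2s})(1−eq^{−(2s−1)})∕((1−q^{−(2s+1)})(1−eq^{−(2s+2)}))] · aNorm 2 χ_v vol s
  = vol·(1−q^{−2s})(1−eq^{−2s})·lEN(2s) ∕ ((1−q^{−(2s+1)})(1−eq^{−(2s+1)})·lEN(2s+1))` off the zero sets of the cancelled factors (★ `aNum_two`∕`bDen_two`, `L_F(z,χ_F) = (1−eq^{−z})⁻¹`);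
  **`…_of_re`** — on `½ < re s` for unitary `χ_v` (all side factors `≠ 0`).
* §2 **`isQRationalRegularAt_modifiedNormaliser`** ∕ **`differentiableOn_modifiedNormaliser`** — the right-hand side is `q_v`-rational regular at every `s₀` with `0 < re s₀`
  (★ `isQRationalRegularAt_lEN_affine`, ★ `lEN_ne_zero`, closure of ★ `K2LiuQRationalDefs`), hence holomorphic on `{0 < re}` (★ p861729).
* §3 THE K2_Liu FRAME **`…_cm`** — `χ` a Hecke character of the CM field `L` with `χ(a_L) = ε(a)` on `𝕀_{L⁺}` (`ε = quadraticHeckeCharCM L`), `χ_w` unitary, `ε` UNRAMIFIED at `v`: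
  `e = ε(ϖ_v)` (★ J1a-dict + ★ σ-9), so `c_v⁻¹` is LITERALLY the `v`-factor of ★ p861784 `invScalar_eq_finsetProd_mul_cm` and the two clauses are the letters `hB`-factor ∕ `hc` of
  ★ `exists_bigCell_continuation_cm_of_faces` at `v ∈ P`.
With ★ p861991 (E7: value at unramified `χ_w`) and 📤 p862028 (E7′: `ε`-ramified places) every finite place of the (β) Euler face now has its scalar letter.
Sources: [HarrisKudlaSweet1996, §6 (6.14)–(6.16)]; [KudlaSweet1997, §1]; [Tate1950, §2.5]; [Harris2007, (1.3.4) p. 92].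
HONEST LABEL.  Helper lemmas, count-neutral; `HC_CM` is proved only modulo the 7 printed citations (2 remaining named inputs:
hLiu418 = `stmt-HodgeConjecture-24832`, h413 = `stmt-HodgeConjecture-24833`) until rung 0 closes.
-/

set_option autoImplicit false
-- the mandated namespace repeats the single-problem summit's segment (`HodgeConjecture.HodgeConjecture`)
set_option linter.dupNamespace false

noncomputable section

open NumberField IsDedekindDomain
open Literature.NumberTheory.GaloisRepresentations Literature.NumberTheory.GaloisRepresentations.IsNonarchimedeanLocalField
open Literature.NumberTheory.Automorphic Literature.NumberTheory.Automorphic.UnitaryGroup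
open Summit.HodgeConjecture.HodgeConjecture.Cruxes.HLiu418.K2LiuQRationalDefs
open Summit.HodgeConjecture.HodgeConjecture.Cruxes.HLiu418.K2LiuLocalLFactorDefs
open Summit.HodgeConjecture.HodgeConjecture.Cruxes.HLiu418.K2LiuQRationalLFactor
open Summit.HodgeConjecture.HodgeConjecture.Cruxes.HLiu418.K2LiuA7NormaliserAlgebra
open Summit.HodgeConjecture.HodgeConjecture.Cruxes.HLiu418.K2LiuBigCellContinuationPointLetters (differentiableOn_re_pos_of_forall_isQRationalRegularAt)
open Summit.HodgeConjecture.HodgeConjecture.Cruxes.HLiu418.K2LiuA7ValueSocketHu (isUnramifiedChar_localComponent_iff unramValue_localComponent_eq_valueAtUniformizer)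
open Summit.HodgeConjecture.HodgeConjecture.Cruxes.H413.K2E1HeckeCharBaseChangeLocalComponentsU (localComponent_eq_prod_of_comp_ideleBaseChange)

namespace Summit.HodgeConjecture.HodgeConjecture.Cruxes.HLiu418.K2LiuSiegelNormaliserTwoModified

section Quadratic

variable (F : Type) [Field F] [NumberField F] (E : Type) [Field E] [NumberField E] [Algebra F E]
  (c : E ≃ₐ[F] E) (v : HeightOneSpectrum (𝓞 F))

/-! ## §1 The algebraic identity `c_v⁻¹ · aNorm 2 = m_v` -/

/-- the cancellation pattern of §1 in a field: `(P₀P₁∕(P₂P₃))·(vol·(P₁⁻¹(L₁∕Q₀⁻¹))∕(P₃⁻¹(L₂∕Q₁⁻¹))) = vol·(P₀Q₀L₁)∕(P₂Q₁L₂)` for `P₁, P₃ ≠ 0`. [folklore] -/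
theorem cancel_pattern (P₀ P₁ P₂ P₃ Q₀ Q₁ L₁ L₂ vol : ℂ) (h1 : P₁ ≠ 0) (h2 : P₃ ≠ 0) :
    P₀ * P₁ / (P₂ * P₃) * (vol * (P₁⁻¹ * (L₁ / Q₀⁻¹) / (P₃⁻¹ * (L₂ / Q₁⁻¹)))) = vol * (P₀ * Q₀ * L₁ / (P₂ * Q₁ * L₂)) := by
  calc P₀ * P₁ / (P₂ * P₃) * (vol * (P₁⁻¹ * (L₁ / Q₀⁻¹) / (P₃⁻¹ * (L₂ / Q₁⁻¹))))
      = vol * (P₀ * Q₀ * L₁) * (P₂⁻¹ * Q₁⁻¹ * L₂⁻¹) * (P₁ * P₁⁻¹) * (P₃⁻¹ * P₃) := by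
        simp only [div_eq_mul_inv, mul_inv, inv_inv]; ring
    _ = vol * (P₀ * Q₀ * L₁ / (P₂ * Q₁ * L₂)) := by
        rw [mul_inv_cancel₀ h1, inv_mul_cancel₀ h2]; simp only [div_eq_mul_inv, mul_inv]; ring

/-- **`c_v(s)⁻¹ · aNorm 2 χ_v vol s = m_v(s)`** with `m_v(s) = vol·(1−q^{−2s})(1−eq^{−2s})·lEN(2s)∕((1−q^{−(2s+1)})(1−eq^{−(2s+1)})·lEN(2s+1))`, `e` the Satake value of `χ_{F,v}`, off the
zero sets of the two cancelled factors (`L_F(2s−1,χ_F)·(1−eq^{−(2s−1)}) = 1`, `L_F(2s+2,χ_F)·(1−eq^{−(2s+2)}) = 1`; no other side condition, Lean's `x∕0 = 0`).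
[cite: HarrisKudlaSweet1996, §6 (6.16)] [cite: KudlaSweet1997, §1] -/
theorem invLocalScalar_mul_aNorm_two_eq {χv : ∀ w : PlacesOver E v, (w.1.adicCompletion E)ˣ →* ℂˣ} {e : ℂ}
    (he : unramValue F v (chiF F E v χv) = e) (vol : ℝ) (s : ℂ)
    (h1 : 1 - e * (v.residueCard : ℂ) ^ (-(2 * s - 1)) ≠ 0) (h2 : 1 - e * (v.residueCard : ℂ) ^ (-(2 * s + 2)) ≠ 0) :
    ((1 - (v.residueCard : ℂ) ^ (-(2 * s))) * (1 - e * (v.residueCard : ℂ) ^ (-(2 * s - 1)))) /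
          ((1 - (v.residueCard : ℂ) ^ (-(2 * s + 1))) * (1 - e * (v.residueCard : ℂ) ^ (-(2 * s + 2)))) *
        aNorm F E c v 2 χv vol s =
      (vol : ℂ) * (((1 - (v.residueCard : ℂ) ^ (-(2 * s))) * (1 - e * (v.residueCard : ℂ) ^ (-(2 * s))) * lEN F E c v χv (2 * s)) /
        ((1 - (v.residueCard : ℂ) ^ (-(2 * s + 1))) * (1 - e * (v.residueCard : ℂ) ^ (-(2 * s + 1))) * lEN F E c v χv (2 * s + 1))) := by
  rw [aNorm_def, aNum_two, bDen_two]
  simp only [lF, lFactor_def, he, residueFieldCard_adicCompletion_eq F v]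
  exact cancel_pattern _ _ _ _ _ _ _ _ _ h1 h2

/-- the four side factors are `≠ 0` on `½ < re s` for unitary `χ_v` and `‖e‖ ≤ 1` (`‖q^{−z}‖ < 1` for `0 < re z`; `L_{E∕F}(2s+1) ≠ 0` ★ `lEN_ne_zero`). [cite: KudlaSweet1997, §1] -/
theorem sideFactors_ne_zero {χv : ∀ w : PlacesOver E v, (w.1.adicCompletion E)ˣ →* ℂˣ}
    (hχ : ∀ (w : PlacesOver E v) (x : (w.1.adicCompletion E)ˣ), ‖((χv w x : ℂˣ) : ℂ)‖ = 1) {e : ℂ} (he1 : ‖e‖ ≤ 1) {s : ℂ} (hs : 1 / 2 < s.re) :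
    1 - e * (v.residueCard : ℂ) ^ (-(2 * s - 1)) ≠ 0 ∧ 1 - e * (v.residueCard : ℂ) ^ (-(2 * s + 2)) ≠ 0 ∧
      1 - (v.residueCard : ℂ) ^ (-(2 * s + 1)) ≠ 0 ∧ lEN F E c v χv (2 * s + 1) ≠ 0 := by
  -- `‖q^{−z}‖ < 1` for `0 < re z` (★ `K2E1FiniteWhittakerInertU3.norm_natCast_cpow_neg_lt_one`, inlined to keep the import light)
  have key : ∀ z : ℂ, 0 < z.re → ‖(v.residueCard : ℂ) ^ (-z)‖ < 1 := fun z hz => by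
    rw [Complex.norm_natCast_cpow_of_pos (lt_trans zero_lt_one v.one_lt_residueCard), Complex.neg_re]
    exact Real.rpow_lt_one_of_one_lt_of_neg (by exact_mod_cast v.one_lt_residueCard) (neg_lt_zero.2 hz)
  have hne : ∀ z : ℂ, 0 < z.re → 1 - e * (v.residueCard : ℂ) ^ (-z) ≠ 0 := fun z hz => by
    refine sub_ne_zero.2 (fun h => ?_)
    have hlt : ‖e * (v.residueCard : ℂ) ^ (-z)‖ < 1 := by
      rw [norm_mul]
      calc ‖e‖ * ‖(v.residueCard : ℂ) ^ (-z)‖ ≤ 1 * ‖(v.residueCard : ℂ) ^ (-z)‖ := by gcongr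
        _ < 1 := by rw [one_mul]; exact key z hz
    rw [← h, norm_one] at hlt
    exact lt_irrefl _ hlt
  refine ⟨hne _ (by simp [Complex.mul_re]; linarith), hne _ (by simp [Complex.mul_re]; linarith), sub_ne_zero.2 (fun h => ?_),
    lEN_ne_zero c χv hχ (by simp [Complex.mul_re]; linarith)⟩
  have hlt := key (2 * s + 1) (by simp [Complex.mul_re]; linarith)
  rw [← h, norm_one] at hlt
  exact lt_irrefl _ hlt

/-- **`c_v⁻¹ · aNorm 2 χ_v vol s = m_v(s)` on `½ < re s`** for unitary `χ_v` and `‖e‖ ≤ 1`. [cite: HarrisKudlaSweet1996, §6 (6.16)] [cite: KudlaSweet1997, §1] -/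
theorem invLocalScalar_mul_aNorm_two_eq_of_re {χv : ∀ w : PlacesOver E v, (w.1.adicCompletion E)ˣ →* ℂˣ}
    (hχ : ∀ (w : PlacesOver E v) (x : (w.1.adicCompletion E)ˣ), ‖((χv w x : ℂˣ) : ℂ)‖ = 1) {e : ℂ}
    (he : unramValue F v (chiF F E v χv) = e) (he1 : ‖e‖ ≤ 1) (vol : ℝ) {s : ℂ} (hs : 1 / 2 < s.re) :
    ((1 - (v.residueCard : ℂ) ^ (-(2 * s))) * (1 - e * (v.residueCard : ℂ) ^ (-(2 * s - 1)))) /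
          ((1 - (v.residueCard : ℂ) ^ (-(2 * s + 1))) * (1 - e * (v.residueCard : ℂ) ^ (-(2 * s + 2)))) *
        aNorm F E c v 2 χv vol s =
      (vol : ℂ) * (((1 - (v.residueCard : ℂ) ^ (-(2 * s))) * (1 - e * (v.residueCard : ℂ) ^ (-(2 * s))) * lEN F E c v χv (2 * s)) /
        ((1 - (v.residueCard : ℂ) ^ (-(2 * s + 1))) * (1 - e * (v.residueCard : ℂ) ^ (-(2 * s + 1))) * lEN F E c v χv (2 * s + 1))) := by
  obtain ⟨h1, h2, -, -⟩ := sideFactors_ne_zero F E c v hχ he1 hs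
  exact invLocalScalar_mul_aNorm_two_eq F E c v he vol s h1 h2

/-! ## §2 The modified normaliser is holomorphic on `{0 < re}` -/

/-- `1 − a·q^{−(2s+r)}` is `q`-rational regular everywhere (`q^{−(2s+r)} = q^{−r}·(q^{−s})²`). [cite: Tate1950, §2.5] -/
theorem isQRationalRegularAt_one_sub_mul_cpow (a : ℂ) (r : ℂ) (s₀ : ℂ) :
    IsQRationalRegularAt v.residueCard s₀ fun s : ℂ => 1 - a * (v.residueCard : ℂ) ^ (-(2 * s + r)) := by
  have hq0 : (v.residueCard : ℂ) ≠ 0 := by exact_mod_cast (lt_trans zero_lt_one v.one_lt_residueCard).ne'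
  refine ((isQRationalRegularAt_const _ s₀ (1 : ℂ)).sub
    ((isQRationalRegularAt_qVar_pow v.residueCard s₀ 2).const_mul (a * (v.residueCard : ℂ) ^ (-r)))).congr fun s => ?_
  simp only [qVar_def]
  rw [show -(2 * s + r) = -r + (-s + -s) by ring, Complex.cpow_add _ _ hq0, Complex.cpow_add _ _ hq0, sq]
  ring

/-- **`m_v` is `q_v`-rational regular at every `s₀` with `0 < re s₀`** (unitary `χ_v`, `‖e‖ ≤ 1`): `L_{E∕F}(2s)`, `L_{E∕F}(2s+1)` regular there (★ `isQRationalRegularAt_lEN_affine`),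
the denominator `(1−q^{−(2s₀+1)})(1−eq^{−(2s₀+1)})·L_{E∕F}(2s₀+1) ≠ 0`. [cite: KudlaSweet1997, §1] [cite: HarrisKudlaSweet1996, §6 (6.16)] -/
theorem isQRationalRegularAt_modifiedNormaliser {χv : ∀ w : PlacesOver E v, (w.1.adicCompletion E)ˣ →* ℂˣ}
    (hχ : ∀ (w : PlacesOver E v) (x : (w.1.adicCompletion E)ˣ), ‖((χv w x : ℂˣ) : ℂ)‖ = 1) {e : ℂ} (he1 : ‖e‖ ≤ 1) (vol : ℝ) {s₀ : ℂ} (hs₀ : 0 < s₀.re) :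
    IsQRationalRegularAt v.residueCard s₀ fun s : ℂ =>
      (vol : ℂ) * (((1 - (v.residueCard : ℂ) ^ (-(2 * s))) * (1 - e * (v.residueCard : ℂ) ^ (-(2 * s))) * lEN F E c v χv (2 * s)) /
        ((1 - (v.residueCard : ℂ) ^ (-(2 * s + 1))) * (1 - e * (v.residueCard : ℂ) ^ (-(2 * s + 1))) * lEN F E c v χv (2 * s + 1))) := by
  have h2 : 0 < ((2 : ℕ) * s₀ + 0 : ℂ).re := by simp [Complex.mul_re]; linarith
  have h3 : 0 < ((2 : ℕ) * s₀ + 1 : ℂ).re := by simp [Complex.mul_re]; linarith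
  have hL0 : IsQRationalRegularAt v.residueCard s₀ fun s : ℂ => lEN F E c v χv (2 * s) := by
    have h := isQRationalRegularAt_lEN_affine c hχ 2 0 h2
    rw [residueFieldCard_adicCompletion_eq F v] at h
    exact h.congr fun s => by simp only [Nat.cast_ofNat, add_zero]
  have hL1 : IsQRationalRegularAt v.residueCard s₀ fun s : ℂ => lEN F E c v χv (2 * s + 1) := by
    have h := isQRationalRegularAt_lEN_affine c hχ 2 1 h3
    rw [residueFieldCard_adicCompletion_eq F v] at h
    exact h.congr fun s => by simp only [Nat.cast_ofNat]
  have hA : IsQRationalRegularAt v.residueCard s₀ fun s : ℂ => 1 - (v.residueCard : ℂ) ^ (-(2 * s)) :=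
    (isQRationalRegularAt_one_sub_mul_cpow F v 1 0 s₀).congr fun s => by rw [one_mul, add_zero]
  have hB : IsQRationalRegularAt v.residueCard s₀ fun s : ℂ => 1 - e * (v.residueCard : ℂ) ^ (-(2 * s)) :=
    (isQRationalRegularAt_one_sub_mul_cpow F v e 0 s₀).congr fun s => by rw [add_zero]
  have hC : IsQRationalRegularAt v.residueCard s₀ fun s : ℂ => 1 - (v.residueCard : ℂ) ^ (-(2 * s + 1)) :=
    (isQRationalRegularAt_one_sub_mul_cpow F v 1 1 s₀).congr fun s => by rw [one_mul]
  have hD : IsQRationalRegularAt v.residueCard s₀ fun s : ℂ => 1 - e * (v.residueCard : ℂ) ^ (-(2 * s + 1)) :=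
    isQRationalRegularAt_one_sub_mul_cpow F v e 1 s₀
  -- the denominator does not vanish at `s₀` (`0 < re s₀` suffices for these three factors)
  have key : ∀ z : ℂ, 0 < z.re → ‖(v.residueCard : ℂ) ^ (-z)‖ < 1 := fun z hz => by
    rw [Complex.norm_natCast_cpow_of_pos (lt_trans zero_lt_one v.one_lt_residueCard), Complex.neg_re]
    exact Real.rpow_lt_one_of_one_lt_of_neg (by exact_mod_cast v.one_lt_residueCard) (neg_lt_zero.2 hz)
  have hz1 : 0 < (2 * s₀ + 1).re := by simp [Complex.mul_re]; linarith
  have hden : (1 - (v.residueCard : ℂ) ^ (-(2 * s₀ + 1))) * (1 - e * (v.residueCard : ℂ) ^ (-(2 * s₀ + 1))) * lEN F E c v χv (2 * s₀ + 1) ≠ 0 := by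
    refine mul_ne_zero (mul_ne_zero (sub_ne_zero.2 fun h => ?_) (sub_ne_zero.2 fun h => ?_)) (lEN_ne_zero c χv hχ hz1)
    · have hlt := key _ hz1
      rw [← h, norm_one] at hlt
      exact lt_irrefl _ hlt
    · have hlt : ‖e * (v.residueCard : ℂ) ^ (-(2 * s₀ + 1))‖ < 1 := by
        rw [norm_mul]
        calc ‖e‖ * ‖(v.residueCard : ℂ) ^ (-(2 * s₀ + 1))‖ ≤ 1 * ‖(v.residueCard : ℂ) ^ (-(2 * s₀ + 1))‖ := by gcongr
          _ < 1 := by rw [one_mul]; exact key _ hz1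
      rw [← h, norm_one] at hlt
      exact lt_irrefl _ hlt
  exact (((hA.mul hB).mul hL0).div ((hC.mul hD).mul hL1) hden).const_mul (vol : ℂ)

/-- **THE MODIFIED NORMALISER IS HOLOMORPHIC ON `{0 < re}`** (unitary `χ_v`, `‖e‖ ≤ 1`) — the letter `hc` of ★ `exists_bigCell_continuation_of_faces` at a `χ_F`-unramified bad place.
[cite: KudlaSweet1997, §1] [cite: HarrisKudlaSweet1996, §6 (6.16)] -/
theorem differentiableOn_modifiedNormaliser {χv : ∀ w : PlacesOver E v, (w.1.adicCompletion E)ˣ →* ℂˣ}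
    (hχ : ∀ (w : PlacesOver E v) (x : (w.1.adicCompletion E)ˣ), ‖((χv w x : ℂˣ) : ℂ)‖ = 1) {e : ℂ} (he1 : ‖e‖ ≤ 1) (vol : ℝ) :
    DifferentiableOn ℂ (fun s : ℂ =>
      (vol : ℂ) * (((1 - (v.residueCard : ℂ) ^ (-(2 * s))) * (1 - e * (v.residueCard : ℂ) ^ (-(2 * s))) * lEN F E c v χv (2 * s)) /
        ((1 - (v.residueCard : ℂ) ^ (-(2 * s + 1))) * (1 - e * (v.residueCard : ℂ) ^ (-(2 * s + 1))) * lEN F E c v χv (2 * s + 1))))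
      {s : ℂ | 0 < s.re} :=
  differentiableOn_re_pos_of_forall_isQRationalRegularAt (lt_trans zero_lt_one v.one_lt_residueCard).ne'
    fun _ hs₀ => isQRationalRegularAt_modifiedNormaliser F E c v hχ he1 vol hs₀

end Quadratic

/-! ## §3 The K2_Liu frame: `e = ε(ϖ_v)` for a parity character at an `ε`-unramified place -/

section CM

variable (L : Type) [Field L] [NumberField L] [IsCMField L] (v : HeightOneSpectrum (𝓞 ↥(maximalRealSubfield L)))

omit [IsCMField L] in
/-- for `χ(a_L) = ε(a)` on `𝕀_{L⁺}` and `ε` unramified at `v`: **the Satake value of `χ_{F,v}((χ_w)_{w∣v})` is `ε(ϖ_v)`** (★ J1a-dict `localComponent_eq_prod_of_comp_ideleBaseChange` +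
★ `chiF_apply` + ★ σ-9 `unramValue_localComponent_eq_valueAtUniformizer`). [cite: CasselsFrohlichANT1967, Ch. VII §4.3] [cite: Tate1950, §2.5] -/
theorem unramValue_chiF_localComponent_eq (χ : HeckeCharacter L) (ε : HeckeCharacter ↥(maximalRealSubfield L))
    (hχε : ∀ a : ideleGroup ↥(maximalRealSubfield L), χ (AdeleRing.ideleBaseChange ↥(maximalRealSubfield L) L a) = ε a) (hur : ε.IsUnramifiedAt v) :
    unramValue ↥(maximalRealSubfield L) v (chiF ↥(maximalRealSubfield L) L v (fun w : PlacesOver L v => χ.localComponent w.1)) = ε.valueAtUniformizer v := by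
  have hF : chiF ↥(maximalRealSubfield L) L v (fun w : PlacesOver L v => χ.localComponent w.1) = ε.localComponent v :=
    MonoidHom.ext fun u => by rw [chiF_apply, localComponent_eq_prod_of_comp_ideleBaseChange χ ε hχε v u]
  rw [hF, unramValue_localComponent_eq_valueAtUniformizer L v ε hur]

/-- **AT AN `ε`-UNRAMIFIED PLACE OF THE K2_Liu FRAME** (`χ` Hecke character of the CM field `L` with `χ|_{𝕀_{L⁺}} = ε = quadraticHeckeCharCM L`, unitary local components, `ε`
unramified at `v`, `½ < re s`): `c_v(s)⁻¹ · aNorm 2 (χ_w)_{w∣v} vol s = m_v(s)` with `c_v⁻¹` THE `v`-FACTOR of ★ p861784 `invScalar_eq_finsetProd_mul_cm` (`e = ε(ϖ_v)`), and `m_v` holomorphic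
on `{0 < re}` — the letters of ★ `exists_bigCell_continuation_cm_of_faces` at `v ∈ P`. [cite: HarrisKudlaSweet1996, §6 (6.14)–(6.16)] [cite: KudlaSweet1997, §1] [cite: Harris2007, (1.3.4) p. 92] -/
theorem invLocalScalar_mul_aNorm_two_eq_cm (χ : HeckeCharacter L)
    (hχε : ∀ a : ideleGroup ↥(maximalRealSubfield L), χ (AdeleRing.ideleBaseChange ↥(maximalRealSubfield L) L a) = quadraticHeckeCharCM L a)
    (hχu : ∀ (w : PlacesOver L v) (x : (w.1.adicCompletion L)ˣ), ‖((χ.localComponent w.1 x : ℂˣ) : ℂ)‖ = 1)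
    (hur : (quadraticHeckeCharCM L).IsUnramifiedAt v) (vol : ℝ) {s : ℂ} (hs : 1 / 2 < s.re) :
    ((1 - (v.residueCard : ℂ) ^ (-(2 * s))) * (1 - (quadraticHeckeCharCM L).valueAtUniformizer v * (v.residueCard : ℂ) ^ (-(2 * s - 1)))) /
          ((1 - (v.residueCard : ℂ) ^ (-(2 * s + 1))) * (1 - (quadraticHeckeCharCM L).valueAtUniformizer v * (v.residueCard : ℂ) ^ (-(2 * s + 2)))) *
        aNorm ↥(maximalRealSubfield L) L (IsCMField.complexConj L : L ≃ₐ[↥(maximalRealSubfield L)] L) v 2 (fun w : PlacesOver L v => χ.localComponent w.1) vol s =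
      (vol : ℂ) * (((1 - (v.residueCard : ℂ) ^ (-(2 * s))) * (1 - (quadraticHeckeCharCM L).valueAtUniformizer v * (v.residueCard : ℂ) ^ (-(2 * s))) *
            lEN ↥(maximalRealSubfield L) L (IsCMField.complexConj L : L ≃ₐ[↥(maximalRealSubfield L)] L) v (fun w : PlacesOver L v => χ.localComponent w.1) (2 * s)) /
        ((1 - (v.residueCard : ℂ) ^ (-(2 * s + 1))) * (1 - (quadraticHeckeCharCM L).valueAtUniformizer v * (v.residueCard : ℂ) ^ (-(2 * s + 1))) *
            lEN ↥(maximalRealSubfield L) L (IsCMField.complexConj L : L ≃ₐ[↥(maximalRealSubfield L)] L) v (fun w : PlacesOver L v => χ.localComponent w.1) (2 * s + 1))) :=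
  invLocalScalar_mul_aNorm_two_eq_of_re ↥(maximalRealSubfield L) L (IsCMField.complexConj L) v hχu
    (unramValue_chiF_localComponent_eq L v χ (quadraticHeckeCharCM L) hχε hur)
    (HeckeCharacter.norm_valueAtUniformizer_of_isUnitary
      (Literature.RepresentationTheory.HarrisKudlaSweet1996.isFiniteOrder_quadraticHeckeCharCM (L := L)).isUnitary v).le vol hs

/-- **… and the modified normaliser of the K2_Liu frame is holomorphic on `{0 < re}`.** [cite: KudlaSweet1997, §1] [cite: HarrisKudlaSweet1996, §6 (6.16)] -/
theorem differentiableOn_modifiedNormaliser_cm (χ : HeckeCharacter L)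
    (hχu : ∀ (w : PlacesOver L v) (x : (w.1.adicCompletion L)ˣ), ‖((χ.localComponent w.1 x : ℂˣ) : ℂ)‖ = 1) (vol : ℝ) :
    DifferentiableOn ℂ (fun s : ℂ =>
      (vol : ℂ) * (((1 - (v.residueCard : ℂ) ^ (-(2 * s))) * (1 - (quadraticHeckeCharCM L).valueAtUniformizer v * (v.residueCard : ℂ) ^ (-(2 * s))) *
            lEN ↥(maximalRealSubfield L) L (IsCMField.complexConj L : L ≃ₐ[↥(maximalRealSubfield L)] L) v (fun w : PlacesOver L v => χ.localComponent w.1) (2 * s)) /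
        ((1 - (v.residueCard : ℂ) ^ (-(2 * s + 1))) * (1 - (quadraticHeckeCharCM L).valueAtUniformizer v * (v.residueCard : ℂ) ^ (-(2 * s + 1))) *
            lEN ↥(maximalRealSubfield L) L (IsCMField.complexConj L : L ≃ₐ[↥(maximalRealSubfield L)] L) v (fun w : PlacesOver L v => χ.localComponent w.1) (2 * s + 1))))
      {s : ℂ | 0 < s.re} :=
  differentiableOn_modifiedNormaliser ↥(maximalRealSubfield L) L (IsCMField.complexConj L) v hχu
    (HeckeCharacter.norm_valueAtUniformizer_of_isUnitary
      (Literature.RepresentationTheory.HarrisKudlaSweet1996.isFiniteOrder_quadraticHeckeCharCM (L := L)).isUnitary v).le vol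

end CM

end Summit.HodgeConjecture.HodgeConjecture.Cruxes.HLiu418.K2LiuSiegelNormaliserTwoModified

end
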